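import Summits.ResolutionOfSingularities.ResolutionOfSingularities.Theorems.FrobeniusLadderFInjectiveMacaulayficationWeightCoaction
import Mathlib.RingTheory.MvPolynomial.WeightedHomogeneous
import Mathlib.RingTheory.Localization.Away.Basic
import Mathlib.RingTheory.Localization.Algebra
import Mathlib.RingTheory.Ideal.Quotient.Operations
import Mathlib.Data.ZMod.Basic
import HarnessLib

/-!
# The weight grading on `(k[X]/J)[1/u]` as a coaction, for a weighted-homogeneous ideal `J` (crux `FInjectiveMacaulayfication`, line H4-gd, piece G1ᵍ)

Support file for crux stmt-ResolutionOfSingularities-15315 (`FrobeniusLadder.FInjectiveMacaulayfication`), line (H4-gd) THE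
GRADED ENGINE FOR A POSITIVELY GRADED AFFINE DOMAIN OF ANY EMBEDDING CODIMENSION (CRUX-PLAN w45a v7 R7.6, typed target
`stub_gradedDomainConeFiModel` of `L/w45a/Stubs-v19.lean`; seat res-L1-w45a-stub-2). [OURS · L1 W4.5a] AI-written; AI review is
weaker than expert review. No statement of Hironaka2017 is used; no external fact is consumed.

This is the generalisation of `…WeightCoaction` (res-L1-w45a-lead-1, H-G1, hypersurface case `J = (f)`) from `k[X]/(f)` to `k[X]/J`
for an ARBITRARY ideal `J ⊆ k[X₁,…,Xₙ]`; the homogeneity of `J` (generation by weighted homogeneous polynomials) enters at exactly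
one place, the existence of the coaction. Setting: `k` a field, weights `w : Fin n → ℕ`, `R = k[X]/J`, `u ∈ R` the class of a
weighted homogeneous polynomial `a₀` of weight `N`, `L = R[1/u]` (`Localization.Away u`). The weight grading of `L` is encoded
WITHOUT any graded-ring structure and without definitions, as a COACTION: a ring map `λ : L → L[T, T⁻¹]` with `x̄ⱼ ↦ x̄ⱼ·T^{wⱼ}`;
`x` is homogeneous of degree `m` iff `λ x = x·T^m`, and the degree-`m` component of `x` is `(λ x)_m`. Everything is stated for an
arbitrary ring map `λ` satisfying the characterising identity `hlam`; its existence (`exists_coaction`) needs `J = (G)` with every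
`g ∈ G` weighted homogeneous.

* `aeval_monomial_eq`, `aeval_of_isWeightedHomogeneous` — the coaction on monomials / homogeneous polynomials;
* `exists_coaction` — the coaction descends to `R = k[X]/(G)` and extends to `L = R[1/u]`;
* `coaction_algebraMap_u`, `coaction_invSelf`, `coaction_monomial_mul_invSelf_pow` — `u/1`, `1/u`, `x̄^b/u^j` are homogeneous;
* `eval₂_one_coaction`, `sum_coeff_coaction`, `eq_sum_coeff` — evaluation at `T = 1` retracts `λ`;
* `away_induction` — additive induction over the monomial fractions;
* `coaction_coeff` — every component of every element is homogeneous of the right degree (coassociativity);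
* `coeff_of_isHomogeneous`, `isHomogeneous_mul`, `isHomogeneous_add`, `coaction_algebraMap`, `coeff_coaction_C_mul` — bookkeeping.
The proofs are those of `…WeightCoaction` verbatim with `Ideal.span {f}` replaced by `J` (the generic Laurent lemmas `prod_T`,
`algebraMap_laurent` are imported from there). No definitions, no named facts. [folklore]
-/

set_option linter.dupNamespace false

noncomputable section

open LaurentPolynomial

namespace Summit.ResolutionOfSingularities.ResolutionOfSingularities.Theorems.FInjectiveMacaulayfication.GradedDomainCoaction

/-! ## Generic Laurent bookkeeping for a ring map `β : L → L[T,T⁻¹]` (any commutative ring `L`) -/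

section Generic

variable {L : Type} [CommRing L] (β : L →+* L[T;T⁻¹])

/-- The components of a `β`-homogeneous element of degree `d`: itself in degree `d`, zero elsewhere. [folklore] -/
theorem coeff_of_isHomogeneous {x : L} {d : ℤ} (hx : β x = C x * T d) (m : ℤ) :
    (β x).coeff m = if m = d then x else 0 := by
  rw [hx, ← single_eq_C_mul_T, AddMonoidAlgebra.coeff_single, Finsupp.single_apply]
  simp only [eq_comm]

/-- Products of `β`-homogeneous elements are homogeneous, degrees add. [folklore] -/
theorem isHomogeneous_mul {x y : L} {d e : ℤ} (hx : β x = C x * T d) (hy : β y = C y * T e) :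
    β (x * y) = C (x * y) * T (d + e) := by
  rw [map_mul, hx, hy, map_mul, T_add]; ring

/-- Sums of `β`-homogeneous elements of the same degree are homogeneous of that degree. [folklore] -/
theorem isHomogeneous_add {x y : L} {d : ℤ} (hx : β x = C x * T d) (hy : β y = C y * T d) :
    β (x + y) = C (x + y) * T d := by
  rw [map_add, hx, hy, map_add, add_mul]

/-- Finite sums of `β`-homogeneous elements of one degree are homogeneous of that degree. [folklore] -/
theorem isHomogeneous_sum {ι : Type} (s : Finset ι) (g : ι → L) (d : ℤ)
    (hg : ∀ i ∈ s, β (g i) = C (g i) * T d) : β (∑ i ∈ s, g i) = C (∑ i ∈ s, g i) * T d := by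
  classical
  induction s using Finset.induction_on with
  | empty => simp
  | insert a s ha ih =>
    rw [Finset.sum_insert ha]
    exact isHomogeneous_add β (hg a (Finset.mem_insert_self a s)) (ih fun i hi => hg i (Finset.mem_insert_of_mem hi))

/-- Components commute with multiplication by a `β`-degree-`0` element. [folklore] -/
theorem coeff_coaction_C_mul {a : L} (ha : β a = C a) (x : L) (m : ℤ) :
    (β (a * x)).coeff m = a * (β x).coeff m := by
  rw [map_mul, ha, ← mul_one (C a), ← T_zero, ← single_eq_C_mul_T, AddMonoidAlgebra.coeff_single_mul_apply, neg_zero,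
    zero_add]

/-- Taking the `m`-th component is additive over finite sums. [folklore] -/
theorem coeff_map_sum {ι : Type} (s : Finset ι) (g : ι → L) (m : ℤ) :
    (β (∑ i ∈ s, g i)).coeff m = ∑ i ∈ s, (β (g i)).coeff m := by
  classical
  induction s using Finset.induction_on with
  | empty => simp
  | insert a s ha ih => rw [Finset.sum_insert ha, Finset.sum_insert ha, map_add, AddMonoidAlgebra.coeff_add,
      Finsupp.add_apply, ih]

/-- A `β`-homogeneous element of degree `d` has no components in degrees `≢ d (mod N')`. [folklore] -/
theorem coeff_eq_zero_of_isHomogeneous (N' : ℕ) {x : L} {d : ℤ} (hx : β x = C x * T d)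
    (m : ℤ) (hm : (m : ZMod N') ≠ (d : ZMod N')) : (β x).coeff m = 0 := by
  rw [coeff_of_isHomogeneous β hx, if_neg]
  rintro rfl
  exact hm rfl

end Generic

/-! ## The coaction on `(k[X]/J)[1/u]` -/

variable {k : Type} [Field k] {n : ℕ} (w : Fin n → ℕ) (J : Ideal (MvPolynomial (Fin n) k))

/-- The class of a constant polynomial, in `L`, is the scalar. [folklore] -/
theorem algebraMap_mk_C (u : MvPolynomial (Fin n) k ⧸ J) (r : k) :
    algebraMap (MvPolynomial (Fin n) k ⧸ J) (Localization.Away u)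
        (Ideal.Quotient.mk J (MvPolynomial.C r)) = algebraMap k (Localization.Away u) r := by
  rw [← MvPolynomial.algebraMap_eq, Ideal.Quotient.mk_algebraMap, ← IsScalarTower.algebraMap_apply]

/-- The coaction `a ↦ a(x̄ⱼ·T^{wⱼ})` on a monomial: `r·X^b ↦ (r·x̄^b/1)·T^{wt b}`. [folklore] -/
theorem aeval_monomial_eq (u : MvPolynomial (Fin n) k ⧸ J) (b : Fin n →₀ ℕ) (r : k) :
    MvPolynomial.aeval (fun j : Fin n => C (algebraMap (MvPolynomial (Fin n) k ⧸ J) (Localization.Away u)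
        (Ideal.Quotient.mk J (MvPolynomial.X j))) * T (w j : ℤ)) (MvPolynomial.monomial b r) =
      C (algebraMap (MvPolynomial (Fin n) k ⧸ J) (Localization.Away u)
        (Ideal.Quotient.mk J (MvPolynomial.monomial b r))) * T (Finsupp.weight w b : ℤ) := by
  classical
  rw [MvPolynomial.aeval_monomial, MvPolynomial.monomial_eq, map_mul, map_mul, Finsupp.prod, Finsupp.prod,
    map_prod, map_prod, Finsupp.weight_apply, Finsupp.sum]
  simp only [mul_pow, ← map_pow, map_mul, map_prod, Finset.prod_mul_distrib, T_pow, WeightCoaction.prod_T, WeightCoaction.algebraMap_laurent,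
    algebraMap_mk_C, smul_eq_mul, Nat.cast_sum, Nat.cast_mul, mul_assoc]

/-- The coaction on a weighted homogeneous polynomial `a` of weight `m`: `a ↦ (ā/1)·T^m`. [folklore] -/
theorem aeval_of_isWeightedHomogeneous (u : MvPolynomial (Fin n) k ⧸ J) {a : MvPolynomial (Fin n) k} {m : ℕ}
    (ha : MvPolynomial.IsWeightedHomogeneous w a m) :
    MvPolynomial.aeval (fun j : Fin n => C (algebraMap (MvPolynomial (Fin n) k ⧸ J) (Localization.Away u)
        (Ideal.Quotient.mk J (MvPolynomial.X j))) * T (w j : ℤ)) a =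
      C (algebraMap (MvPolynomial (Fin n) k ⧸ J) (Localization.Away u)
        (Ideal.Quotient.mk J a)) * T (m : ℤ) := by
  classical
  conv_lhs => rw [MvPolynomial.as_sum a]
  conv_rhs => rw [MvPolynomial.as_sum a]
  rw [map_sum, map_sum, map_sum, map_sum, Finset.sum_mul]
  refine Finset.sum_congr rfl fun b hb => ?_
  rw [aeval_monomial_eq]
  congr 2
  exact_mod_cast ha (MvPolynomial.mem_support_iff.mp hb)

variable (u : MvPolynomial (Fin n) k ⧸ J) {N : ℕ} {a₀ : MvPolynomial (Fin n) k}
  (ha₀ : MvPolynomial.IsWeightedHomogeneous w a₀ N) (hu : Ideal.Quotient.mk J a₀ = u)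

include ha₀ hu in
/-- **Existence of the coaction (G1ᵍ).** For `J = (G)` with every `g ∈ G` weighted homogeneous and `u` the class of a
weighted homogeneous `a₀` of weight `N`, the substitution `a ↦ a(x̄ⱼ·T^{wⱼ})` kills `J` (a generator `g` of weight `D` goes to
`(ḡ/1)·T^D = 0`, and the kernel is an ideal), so it descends to `R = k[X]/J`, and it sends `u` to the unit `(u/1)·T^N`, so it
extends to `L = R[1/u]` (`IsLocalization.Away.lift`). [folklore] -/
theorem exists_coaction (G : Set (MvPolynomial (Fin n) k)) (hGJ : Ideal.span G = J)
    (hG : ∀ g ∈ G, ∃ D : ℕ, MvPolynomial.IsWeightedHomogeneous w g D) :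
    ∃ lam : Localization.Away u →+* (Localization.Away u)[T;T⁻¹],
      ∀ a : MvPolynomial (Fin n) k,
        lam (algebraMap (MvPolynomial (Fin n) k ⧸ J) _ (Ideal.Quotient.mk J a)) =
          MvPolynomial.aeval (fun j : Fin n => C (algebraMap (MvPolynomial (Fin n) k ⧸ J)
            (Localization.Away u) (Ideal.Quotient.mk J (MvPolynomial.X j))) * T (w j : ℤ)) a := by
  subst hu
  have hker : ∀ a ∈ J, (MvPolynomial.aeval (R := k) (fun j : Fin n => C (algebraMap (MvPolynomial (Fin n) k ⧸ J)
      (Localization.Away (Ideal.Quotient.mk J a₀)) (Ideal.Quotient.mk J (MvPolynomial.X j))) * T (w j : ℤ))).toRingHom a = 0 := by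
    intro a ha
    rw [← hGJ] at ha
    rw [← RingHom.mem_ker]
    refine (Ideal.span_le (I := RingHom.ker _)).mpr ?_ ha
    intro g hg
    obtain ⟨D, hD⟩ := hG g hg
    have hg0 : Ideal.Quotient.mk J g = 0 := Ideal.Quotient.eq_zero_iff_mem.mpr (hGJ ▸ Ideal.subset_span hg)
    rw [SetLike.mem_coe, RingHom.mem_ker, AlgHom.toRingHom_eq_coe, RingHom.coe_coe, aeval_of_isWeightedHomogeneous w J _ hD,
      hg0, map_zero, map_zero, zero_mul]
  have hgR_mk : ∀ a, Ideal.Quotient.lift J _ hker (Ideal.Quotient.mk J a) =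
      MvPolynomial.aeval (R := k) (fun j : Fin n => C (algebraMap (MvPolynomial (Fin n) k ⧸ J)
      (Localization.Away (Ideal.Quotient.mk J a₀)) (Ideal.Quotient.mk J (MvPolynomial.X j))) * T (w j : ℤ)) a := fun a => by
    rw [Ideal.Quotient.lift_mk]; rfl
  -- `u ↦ (u/1)·T^N`, a unit
  have hgu : Ideal.Quotient.lift J _ hker (Ideal.Quotient.mk J a₀) =
      C (algebraMap _ (Localization.Away (Ideal.Quotient.mk J a₀)) (Ideal.Quotient.mk J a₀)) *
        T (N : ℤ) := by
    rw [hgR_mk, aeval_of_isWeightedHomogeneous w J _ ha₀]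
  have hunit : IsUnit (Ideal.Quotient.lift J _ hker (Ideal.Quotient.mk J a₀)) := by
    rw [hgu]
    exact ((IsLocalization.Away.algebraMap_isUnit _).map C).mul (isUnit_T _)
  refine ⟨IsLocalization.Away.lift _ hunit, fun a => ?_⟩
  rw [IsLocalization.Away.lift_eq, hgR_mk]

variable (lam : Localization.Away u →+* (Localization.Away u)[T;T⁻¹])
variable (hlam : ∀ a : MvPolynomial (Fin n) k,
        lam (algebraMap (MvPolynomial (Fin n) k ⧸ J) _ (Ideal.Quotient.mk J a)) =
          MvPolynomial.aeval (fun j : Fin n => C (algebraMap (MvPolynomial (Fin n) k ⧸ J)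
            (Localization.Away u) (Ideal.Quotient.mk J (MvPolynomial.X j))) * T (w j : ℤ)) a)
include hlam

section
include ha₀ hu

/-- `u/1` is homogeneous of degree `N`. [folklore] -/
theorem coaction_algebraMap_u :
    lam (algebraMap (MvPolynomial (Fin n) k ⧸ J) (Localization.Away u) u) =
      C (algebraMap (MvPolynomial (Fin n) k ⧸ J) (Localization.Away u) u) * T (N : ℤ) := by
  subst hu
  rw [hlam, aeval_of_isWeightedHomogeneous w J _ ha₀]

/-- `1/u` is homogeneous of degree `-N` (inverse of the unit `(u/1)·T^N`). [folklore] -/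
theorem coaction_invSelf :
    lam (IsLocalization.Away.invSelf (R := MvPolynomial (Fin n) k ⧸ J) u) =
      C (IsLocalization.Away.invSelf (R := MvPolynomial (Fin n) k ⧸ J) (S := Localization.Away u) u) * T (-(N : ℤ)) := by
  have h1 : lam (algebraMap _ (Localization.Away u) u) * lam (IsLocalization.Away.invSelf u) = 1 := by
    rw [← map_mul, IsLocalization.Away.mul_invSelf, map_one]
  have h2 : C (algebraMap _ (Localization.Away u) u) * T (N : ℤ) *
      (C (IsLocalization.Away.invSelf (S := Localization.Away u) u) * T (-(N : ℤ))) = 1 := by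
    rw [mul_mul_mul_comm, ← map_mul, IsLocalization.Away.mul_invSelf, map_one, one_mul, ← T_add, add_neg_cancel, T_zero]
  calc lam (IsLocalization.Away.invSelf u)
      = lam (IsLocalization.Away.invSelf u) * (C (algebraMap _ (Localization.Away u) u) * T (N : ℤ) *
          (C (IsLocalization.Away.invSelf (S := Localization.Away u) u) * T (-(N : ℤ)))) := by rw [h2, mul_one]
    _ = lam (algebraMap _ (Localization.Away u) u) * lam (IsLocalization.Away.invSelf u) *
          (C (IsLocalization.Away.invSelf (S := Localization.Away u) u) * T (-(N : ℤ))) := by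
        rw [coaction_algebraMap_u w J u ha₀ hu lam hlam]; ring
    _ = _ := by rw [h1, one_mul]

/-- The monomial fractions `r·x̄^b / u^j` are homogeneous of degree `wt b - j·N`. [folklore] -/
theorem coaction_monomial_mul_invSelf_pow (b : Fin n →₀ ℕ) (r : k) (j : ℕ) :
    lam (algebraMap _ (Localization.Away u) (Ideal.Quotient.mk J (MvPolynomial.monomial b r)) *
        IsLocalization.Away.invSelf u ^ j) =
      C (algebraMap _ (Localization.Away u) (Ideal.Quotient.mk J (MvPolynomial.monomial b r)) *
        IsLocalization.Away.invSelf u ^ j) * T ((Finsupp.weight w b : ℤ) - j * N) := by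
  rw [map_mul, map_pow, hlam, aeval_monomial_eq, coaction_invSelf w J u ha₀ hu lam hlam, mul_pow, ← map_pow, T_pow,
    mul_mul_mul_comm, ← map_mul, ← T_add]
  congr 2
  ring

end

/-- Evaluation at `T = 1` retracts the coaction: `(λ x)(1) = x` (checked on the generators `x̄ⱼ`, the scalars,
and extended through the quotient and the localisation by the ring-map extensionality lemmas). [folklore] -/
theorem eval₂_one_coaction (x : Localization.Away (u : MvPolynomial (Fin n) k ⧸ J)) :
    LaurentPolynomial.eval₂ (RingHom.id _) 1 (lam x) = x := by
  suffices h : (LaurentPolynomial.eval₂ (RingHom.id (Localization.Away u)) 1).comp lam = RingHom.id _ from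
    RingHom.congr_fun h x
  refine IsLocalization.ringHom_ext (Submonoid.powers u) ?_
  refine Ideal.Quotient.ringHom_ext ?_
  refine MvPolynomial.ringHom_ext (fun r => ?_) (fun j => ?_)
  · show LaurentPolynomial.eval₂ _ 1 (lam (algebraMap _ (Localization.Away u)
        (Ideal.Quotient.mk J (MvPolynomial.C r)))) =
      algebraMap _ (Localization.Away u) (Ideal.Quotient.mk J (MvPolynomial.C r))
    rw [hlam, MvPolynomial.aeval_C, WeightCoaction.algebraMap_laurent, eval₂_C, algebraMap_mk_C]
    rfl
  · simp only [RingHom.comp_apply, hlam, MvPolynomial.aeval_X, map_mul, eval₂_C, eval₂_T, RingHom.id_apply, one_zpow,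
      Units.val_one, mul_one]

/-- Every element is the sum of its weight components: `∑ₘ (λ x)_m = x`. [folklore] -/
theorem sum_coeff_coaction (x : Localization.Away (u : MvPolynomial (Fin n) k ⧸ J)) :
    ((lam x).coeff.sum fun _ r => r) = x := by
  conv_rhs => rw [← eval₂_one_coaction w J u lam hlam x, ← AddMonoidAlgebra.sum_coeff_single (lam x)]
  rw [map_finsuppSum]
  refine Finsupp.sum_congr fun m _ => ?_
  rw [single_eq_C_mul_T, eval₂_C_mul_T]
  simp

omit hlam in
/-- **Induction over the monomial fractions.** An additively closed predicate containing `0` and every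
`(r·x̄^b/1)·(1/u)^j` holds on all of `L = R[1/u]` (every element is `(ā/1)·(1/u)^j`, and `a` is a sum of
monomials). [folklore] -/
theorem away_induction {P : Localization.Away u → Prop}
    (h0 : P 0) (hadd : ∀ x y, P x → P y → P (x + y))
    (hgen : ∀ (b : Fin n →₀ ℕ) (r : k) (j : ℕ), P (algebraMap _ _ (Ideal.Quotient.mk J (MvPolynomial.monomial b r)) *
        IsLocalization.Away.invSelf u ^ j))
    (x : Localization.Away u) : P x := by
  obtain ⟨j, r, hx⟩ : ∃ (j : ℕ) (r : MvPolynomial (Fin n) k ⧸ J),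
      x = algebraMap _ (Localization.Away u) r * IsLocalization.Away.invSelf u ^ j := by
    obtain ⟨⟨r, s⟩, rfl⟩ := IsLocalization.mk'_surjective (Submonoid.powers u) x
    obtain ⟨j, hj⟩ := (Submonoid.mem_powers_iff _ _).mp s.2
    refine ⟨j, r, ?_⟩
    dsimp only
    rw [IsLocalization.mk'_eq_iff_eq_mul, mul_assoc, ← hj, map_pow, ← mul_pow, mul_comm (IsLocalization.Away.invSelf u),
      IsLocalization.Away.mul_invSelf, one_pow, mul_one]
  subst hx
  obtain ⟨a, rfl⟩ := Ideal.Quotient.mk_surjective r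
  rw [MvPolynomial.as_sum a, map_sum, map_sum, Finset.sum_mul]
  induction a.support using Finset.induction_on with
  | empty => simpa using h0
  | insert b s hb ih => rw [Finset.sum_insert hb]; exact hadd _ _ (hgen b _ j) ih

section
include ha₀ hu

/-- **Every component is homogeneous**: `λ ((λ x)_m) = (λ x)_m · T^m` for all `x ∈ L` and `m ∈ ℤ` (by
`away_induction`: the statement is additive in `x` and holds for the homogeneous monomial fractions). This is the
coassociativity of the coaction, i.e. the weight decomposition `L = ⊕ₘ Lₘ`. [folklore] -/
theorem coaction_coeff (x : Localization.Away (u : MvPolynomial (Fin n) k ⧸ J)) (m : ℤ) :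
    lam ((lam x).coeff m) = C ((lam x).coeff m) * T m := by
  revert m
  refine away_induction J u (P := fun x => ∀ m : ℤ, lam ((lam x).coeff m) = C ((lam x).coeff m) * T m) ?_ ?_ ?_ x
  · intro m
    simp
  · intro x y hx hy m
    simp only [map_add, AddMonoidAlgebra.coeff_add, Finsupp.add_apply, hx m, hy m, add_mul]
  · intro b r j m
    rw [coeff_of_isHomogeneous lam (coaction_monomial_mul_invSelf_pow w J u ha₀ hu lam hlam b r j)]
    split_ifs with h
    · rw [h]; exact coaction_monomial_mul_invSelf_pow w J u ha₀ hu lam hlam b r j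
    · simp

end

/-- Scalars from `k` are homogeneous of degree `0`. [folklore] -/
theorem coaction_algebraMap (r : k) :
    lam (algebraMap k (Localization.Away (u : MvPolynomial (Fin n) k ⧸ J)) r) = C (algebraMap k (Localization.Away u) r) := by
  rw [← algebraMap_mk_C J u, hlam, MvPolynomial.aeval_C, WeightCoaction.algebraMap_laurent, algebraMap_mk_C]

/-- Every element is the finite sum of its components over the support of `λ x`. [folklore] -/
theorem eq_sum_coeff (x : Localization.Away (u : MvPolynomial (Fin n) k ⧸ J)) :
    x = ∑ m ∈ (lam x).coeff.support, (lam x).coeff m := by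
  conv_lhs => rw [← sum_coeff_coaction w J u lam hlam x]
  rfl

end Summit.ResolutionOfSingularities.ResolutionOfSingularities.Theorems.FInjectiveMacaulayfication.GradedDomainCoaction

end
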